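import Mathlib
import Summits.CriticalPhenomena.Ising3DConformalLimit.Theorems.PrecisionLaplacianEtaBoundsTransferFourier
import Summits.CriticalPhenomena.Ising3DConformalLimit.Theorems.PrecisionLaplacianEtaBoundsTransferIntegral
import HarnessLib

/-!
# TwoPointSpineGlue (route PrecisionLaplacian, item stmt-CriticalPhenomena-4805) — the polarized Parseval
# identity for the Green function of the walk

Helper file 11.  Fourier analysis on the Brillouin zone `K = [-π,π]^d` for an even step law `q` on `ℤᵈ`
with convolution powers `P n` and symbol `φ(k) = ∑_y q(y) cos(k·y)`:

* `parseval_block_two` — for an even summable `f` and finite `B, B'`: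
  `∫_K f̂_c(k) W_{B,B'}(k) dk = (2π)^d ∑_{y∈B, y'∈B'} f(y − y')`, `W_{B,B'}(k) = ∑_{y∈B,y'∈B'} cos(k·(y−y'))`
  (the two-set version of `…EtaBoundsTransferOrtho.parseval_block`);
* `integrableOn_norm_rpow_neg` — `‖k‖^{-α}` is integrable on `K` for `0 ≤ α < d`;
* `neg_one_lt_fourier` — `φ > -1` on `K` as soon as `q > 0` at a site and at its `d` forward
  neighbours (aperiodicity);
* `green_block_two_eq` — **`∑_{y∈B,y'∈B'} G_q(y − y') = (2π)^{-d} ∫_K W_{B,B'}(k) / (1 − φ(k)) dk`** for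
  the Green function `G_q = ∑_n P n`, granted the symbol bound `1 − φ(k) ≥ c₁‖k‖^α` (`α < d`):
  Parseval for each power, the geometric series `∑ φ^n = 1/(1−φ)` off the origin, dominated
  convergence with the majorant `(2/c₁)‖k‖^{-α} |W|`.

No definitions are introduced.  References: F. Spitzer, *Principles of Random Walk* (1976), §7;
G. Lawler, V. Limic (2010), §4.
-/

noncomputable section

namespace Summit.CriticalPhenomena.Ising3DConformalLimit.Theorems.SpineGlue

open Finset Real Filter Topology MeasureTheory Literature.Probability.LatticeModels
open Summit.CriticalPhenomena.Ising3DConformalLimit.Theorems.EtaBoundsTransfer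
open scoped BigOperators

section Parseval

variable {d : ℕ}

/-- **Polarized Parseval identity against a two-set block weight**: for an even summable
`f : ℤ^d → ℝ` and finite sets `B, B'`,
`∫_{[-π,π]^d} f̂_c(k) · ∑_{y∈B,y'∈B'} cos(k·(y − y')) dk = (2π)^d ∑_{y∈B,y'∈B'} f (y − y')`. -/
theorem parseval_block_two {f : Site d → ℝ} (hf : Summable f) (hfev : ∀ z, f (-z) = f z)
    (B B' : Finset (Site d)) :
    ∫ k in Set.pi Set.univ (fun _ : Fin d => Set.Icc (-π) π),
        (∑' z, f z * Real.cos (phase d k z)) * (∑ y ∈ B, ∑ y' ∈ B', Real.cos (phase d k (y - y')))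
      = (2 * π) ^ d * ∑ y ∈ B, ∑ y' ∈ B', f (y - y') := by
  set K := Set.pi Set.univ (fun _ : Fin d => Set.Icc (-π) π) with hK
  set μ : Measure (Fin d → ℝ) := volume.restrict K with hμ
  haveI : IsFiniteMeasure μ := ⟨by rw [hμ, Measure.restrict_apply_univ]; exact volume_cube_lt_top⟩
  set W : (Fin d → ℝ) → ℝ := fun k => ∑ y ∈ B, ∑ y' ∈ B', Real.cos (phase d k (y - y')) with hW
  have hWcont : Continuous W := by
    simp only [hW]
    refine continuous_finsetSum _ fun y _ => continuous_finsetSum _ fun y' _ => ?_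
    have := continuous_phase (d := d) (y - y'); fun_prop
  have hWbd : ∀ k, |W k| ≤ (B.card : ℝ) * B'.card := by
    intro k
    simp only [hW]
    calc |∑ y ∈ B, ∑ y' ∈ B', Real.cos (phase d k (y - y'))|
        ≤ ∑ y ∈ B, |∑ y' ∈ B', Real.cos (phase d k (y - y'))| := Finset.abs_sum_le_sum_abs _ _
      _ ≤ ∑ y ∈ B, ∑ y' ∈ B', |Real.cos (phase d k (y - y'))| :=
          Finset.sum_le_sum fun y _ => Finset.abs_sum_le_sum_abs _ _
      _ ≤ ∑ y ∈ B, ∑ y' ∈ B', (1 : ℝ) :=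
          Finset.sum_le_sum fun y _ => Finset.sum_le_sum fun y' _ => Real.abs_cos_le_one _
      _ = (B.card : ℝ) * B'.card := by simp
  set F : Site d → (Fin d → ℝ) → ℝ := fun z k => f z * Real.cos (phase d k z) * W k with hF
  have hFcont : ∀ z, Continuous (F z) := by
    intro z; simp only [hF]; have := continuous_phase (d := d) z; fun_prop
  have hFint : ∀ z, Integrable (F z) μ := fun z =>
    integrableOn_cube_of_continuous (hFcont z)
  have hFbd : ∀ z k, ‖F z k‖ ≤ |f z| * ((B.card : ℝ) * B'.card) := by
    intro z k
    rw [Real.norm_eq_abs, hF]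
    simp only
    rw [abs_mul, abs_mul]
    calc |f z| * |Real.cos (phase d k z)| * |W k| ≤ |f z| * 1 * ((B.card : ℝ) * B'.card) :=
          mul_le_mul (mul_le_mul_of_nonneg_left (Real.abs_cos_le_one _) (abs_nonneg _)) (hWbd k)
            (abs_nonneg _) (by positivity)
      _ = |f z| * ((B.card : ℝ) * B'.card) := by ring
  have hFsum : Summable fun z => ∫ k, ‖F z k‖ ∂μ := by
    refine Summable.of_nonneg_of_le (fun z => integral_nonneg fun k => norm_nonneg _)
      (fun z => ?_) ((hf.abs.mul_right ((B.card : ℝ) * B'.card)).mul_right (μ.real Set.univ))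
    calc ∫ k, ‖F z k‖ ∂μ ≤ ∫ k, |f z| * ((B.card : ℝ) * B'.card) ∂μ :=
          integral_mono (hFint z).norm (integrable_const _) (hFbd z)
      _ = |f z| * ((B.card : ℝ) * B'.card) * μ.real Set.univ := by
          rw [integral_const, smul_eq_mul]; ring
  -- swap integral and sum
  have hswap : ∫ k, (∑' z, f z * Real.cos (phase d k z)) * W k ∂μ = ∑' z, ∫ k, F z k ∂μ := by
    rw [integral_tsum_of_summable_integral_norm hFint hFsum]
    refine integral_congr_ae (Filter.Eventually.of_forall fun k => ?_)
    simp only [hF]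
    rw [← tsum_mul_right]
  -- compute each integral
  have hterm : ∀ z, ∫ k, F z k ∂μ
      = (2 * π) ^ d / 2 * (f z * ∑ y ∈ B, ∑ y' ∈ B',
          ((if z = y - y' then 1 else 0) + (if z = -(y - y') then 1 else 0))) := by
    intro z
    simp only [hF, hW]
    have h1 : ∀ k : Fin d → ℝ, f z * Real.cos (phase d k z) * ∑ y ∈ B, ∑ y' ∈ B', Real.cos (phase d k (y - y'))
        = ∑ y ∈ B, ∑ y' ∈ B', f z * (Real.cos (phase d k z) * Real.cos (phase d k (y - y'))) := by
      intro k
      rw [Finset.mul_sum]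
      refine Finset.sum_congr rfl fun y _ => ?_
      rw [Finset.mul_sum]
      refine Finset.sum_congr rfl fun y' _ => ?_
      ring
    simp_rw [h1]
    have hi : ∀ y y', Integrable (fun k : Fin d → ℝ =>
        f z * (Real.cos (phase d k z) * Real.cos (phase d k (y - y')))) μ := by
      intro y y'
      refine integrableOn_cube_of_continuous ?_
      have := continuous_phase (d := d) z; have := continuous_phase (d := d) (y - y'); fun_prop
    rw [integral_finsetSum _ (fun y _ => integrable_finsetSum _ (fun y' _ => hi y y'))]
    simp_rw [integral_finsetSum _ (fun y' _ => hi _ y'), integral_const_mul]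
    rw [Finset.mul_sum, Finset.mul_sum]
    refine Finset.sum_congr rfl fun y _ => ?_
    rw [Finset.mul_sum, Finset.mul_sum]
    refine Finset.sum_congr rfl fun y' _ => ?_
    rw [show (∫ k, Real.cos (phase d k z) * Real.cos (phase d k (y - y')) ∂μ)
        = (2 * π) ^ d / 2 * ((if z = y - y' then 1 else 0) + (if z = -(y - y') then 1 else 0))
        from integral_cube_cos_mul_cos z (y - y')]
    ring
  rw [hswap]
  simp_rw [hterm]
  rw [tsum_mul_left]
  -- evaluate the sums of indicators
  have hval : ∑' z, f z * ∑ y ∈ B, ∑ y' ∈ B',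
      ((if z = y - y' then (1:ℝ) else 0) + (if z = -(y - y') then 1 else 0))
      = ∑ y ∈ B, ∑ y' ∈ B', (f (y - y') + f (-(y - y'))) := by
    have h2 : ∀ z, f z * ∑ y ∈ B, ∑ y' ∈ B',
        ((if z = y - y' then (1:ℝ) else 0) + (if z = -(y - y') then 1 else 0))
        = ∑ y ∈ B, ∑ y' ∈ B', ((if z = y - y' then f z else 0) + (if z = -(y - y') then f z else 0)) := by
      intro z
      rw [Finset.mul_sum]
      refine Finset.sum_congr rfl fun y _ => ?_
      rw [Finset.mul_sum]
      refine Finset.sum_congr rfl fun y' _ => ?_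
      split_ifs <;> ring
    simp_rw [h2]
    have hsa : ∀ w : Site d, Summable fun z => (if z = w then f z else 0) := by
      intro w
      apply summable_of_ne_finset_zero (s := {w})
      intro z hz; rw [Finset.mem_singleton] at hz; rw [if_neg hz]
    have hva : ∀ w : Site d, ∑' z, (if z = w then f z else 0) = f w := by
      intro w
      rw [tsum_eq_single w (fun z hz => if_neg hz)]
      rw [if_pos rfl]
    rw [Summable.tsum_finsetSum (fun y _ => summable_sum (fun y' _ => (hsa _).add (hsa _)))]
    refine Finset.sum_congr rfl fun y _ => ?_
    rw [Summable.tsum_finsetSum (fun y' _ => (hsa _).add (hsa _))]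
    refine Finset.sum_congr rfl fun y' _ => ?_
    rw [Summable.tsum_add (hsa _) (hsa _), hva, hva]
  rw [hval]
  simp_rw [hfev]
  rw [Finset.mul_sum, Finset.mul_sum]
  refine Finset.sum_congr rfl fun y _ => ?_
  rw [Finset.mul_sum, Finset.mul_sum]
  refine Finset.sum_congr rfl fun y' _ => ?_
  ring

/-- `‖k‖^{-α}` is integrable on the Brillouin zone for `0 ≤ α < d` (product majorant
`∏_j |k_j|^{-α/d}`). -/
theorem integrableOn_norm_rpow_neg (hd : 1 ≤ d) {α : ℝ} (hα0 : 0 ≤ α) (hαd : α < d) :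
    IntegrableOn (fun k : Fin d → ℝ => ‖k‖ ^ (-α)) (Set.pi Set.univ (fun _ : Fin d => Set.Icc (-π) π)) := by
  have hπ := Real.pi_pos
  have hdpos : (0 : ℝ) < d := by exact_mod_cast hd
  set s : ℝ := α / d with hs
  have hs1 : s < 1 := (div_lt_one hdpos).2 hαd
  set K := Set.pi Set.univ (fun _ : Fin d => Set.Icc (-π) π) with hK
  set g : ℝ → ℝ := fun t => |t| ^ (-s) with hg
  set Gm : (Fin d → ℝ) → ℝ := fun k => ∏ j : Fin d, g (k j) with hGm
  have hμ : (volume : Measure (Fin d → ℝ)).restrict K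
      = Measure.pi (fun _ : Fin d => (volume : Measure ℝ).restrict (Set.Icc (-π) π)) := by
    rw [MeasureTheory.volume_pi, hK, Measure.restrict_pi_pi]
  have hg_int : Integrable g ((volume : Measure ℝ).restrict (Set.Icc (-π) π)) := by
    have h := intervalIntegrable_abs_rpow_neg hs1 (-π) π
    rw [intervalIntegrable_iff_integrableOn_Icc_of_le (by linarith)] at h
    exact h
  have hGm_int : Integrable Gm ((volume : Measure (Fin d → ℝ)).restrict K) := by
    rw [hμ]
    exact Integrable.fintype_prod (f := fun _ : Fin d => g) (fun _ => hg_int)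
  have hmeas : AEStronglyMeasurable (fun k : Fin d → ℝ => ‖k‖ ^ (-α))
      ((volume : Measure (Fin d → ℝ)).restrict K) :=
    ((continuous_norm.measurable).pow_const _).aestronglyMeasurable
  refine Integrable.mono' hGm_int hmeas ?_
  filter_upwards [ae_restrict_of_ae (ae_forall_coord_ne_zero (d := d))] with k hk0
  rw [Real.norm_eq_abs, abs_of_nonneg (Real.rpow_nonneg (norm_nonneg _) _)]
  exact norm_rpow_neg_le_prod hd hα0 hk0

/-- **Aperiodicity, lower side**: `φ(k) > -1` on the Brillouin zone as soon as `q > 0` at some site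
`y₁` and at `y₁ + eᵢ` for all `i` (a value `φ(k) = -1` forces `cos(k·y₁) = cos(k·y₁ + kᵢ) = -1`,
hence `kᵢ = 0` for all `i`, and then `φ(0) = 1`). -/
theorem neg_one_lt_fourier {q : Site d → ℝ} (hq0 : ∀ y, 0 ≤ q y) (hqs : Summable q)
    (hq1 : ∑' y, q y = 1) (y₁ : Site d) (hy₁ : 0 < q y₁) (hy₁' : ∀ i : Fin d, 0 < q (y₁ + Pi.single i 1))
    {k : Fin d → ℝ} (hk : ‖k‖ ≤ π) :
    -1 < ∑' y, q y * Real.cos (phase d k y) := by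
  -- `1 + φ(k) = ∑ q(y) (1 + cos(k·y))`
  have hsc : Summable fun y => q y * Real.cos (phase d k y) :=
    Summable.of_norm_bounded hqs fun y => by
      rw [Real.norm_eq_abs, abs_mul, abs_of_nonneg (hq0 y)]
      exact mul_le_of_le_one_right (hq0 y) (Real.abs_cos_le_one _)
  have hnn : ∀ y, 0 ≤ q y * (1 + Real.cos (phase d k y)) :=
    fun y => mul_nonneg (hq0 y) (by linarith [Real.neg_one_le_cos (phase d k y)])
  have hsum : Summable fun y => q y * (1 + Real.cos (phase d k y)) := by
    have : (fun y => q y * (1 + Real.cos (phase d k y))) = fun y => q y + q y * Real.cos (phase d k y) := by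
      funext y; ring
    rw [this]; exact hqs.add hsc
  have hid : ∑' y, q y * (1 + Real.cos (phase d k y)) = 1 + ∑' y, q y * Real.cos (phase d k y) := by
    calc ∑' y, q y * (1 + Real.cos (phase d k y)) = ∑' y, (q y + q y * Real.cos (phase d k y)) :=
          tsum_congr fun y => by ring
      _ = ∑' y, q y + ∑' y, q y * Real.cos (phase d k y) := hqs.tsum_add hsc
      _ = 1 + ∑' y, q y * Real.cos (phase d k y) := by rw [hq1]
  suffices h : 0 < ∑' y, q y * (1 + Real.cos (phase d k y)) by linarith
  refine lt_of_le_of_ne (tsum_nonneg hnn) fun h0 => ?_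
  have hzero := (hasSum_zero_iff_of_nonneg hnn).1 (by rw [h0]; exact hsum.hasSum)
  have hcos : ∀ y, 0 < q y → Real.cos (phase d k y) = -1 := by
    intro y hy
    have := congr_fun hzero y
    simp only [Pi.zero_apply, mul_eq_zero] at this
    rcases this with h1 | h1
    · exact absurd h1 hy.ne'
    · linarith
  -- `cos(k·y₁) = -1` and `cos(k·y₁ + kᵢ) = -1` force `kᵢ = 0`
  have hk0 : k = 0 := by
    obtain ⟨m, hm⟩ := Real.cos_eq_neg_one_iff.1 (hcos y₁ hy₁)
    funext i
    obtain ⟨m', hm'⟩ := Real.cos_eq_neg_one_iff.1 (hcos _ (hy₁' i))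
    have hki : k i = (m' - m : ℤ) * (2 * π) := by
      have h1 : phase d k (y₁ + Pi.single i 1) = phase d k y₁ + k i := by
        rw [phase_add]
        simp [phase, Pi.single_apply]
      rw [h1, ← hm] at hm'
      push_cast
      linarith
    have habs : |k i| ≤ π := by
      have := norm_le_pi_norm k i; rw [Real.norm_eq_abs] at this; exact this.trans hk
    have hint : (m' - m : ℤ) = 0 := by
      by_contra hne
      have h1 : (1 : ℝ) ≤ |((m' - m : ℤ) : ℝ)| := by
        rw [← Int.cast_abs]; exact_mod_cast Int.one_le_abs hne
      have h2 : |k i| = |((m' - m : ℤ) : ℝ)| * (2 * π) := by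
        rw [hki, abs_mul, abs_of_pos (show (0 : ℝ) < 2 * π by positivity)]
      have : 2 * π ≤ |k i| := by rw [h2]; nlinarith [Real.pi_pos]
      linarith [Real.pi_pos]
    rw [hki, hint]
    simp
  -- but then `cos(k·y₁) = cos 0 = 1 ≠ -1`
  have := hcos y₁ hy₁
  rw [hk0] at this
  simp [phase] at this
  norm_num at this

/-- **The polarized Parseval identity for the Green function of the walk.**  For an even step law
`q` (probability, with `q > 0` at a site and its forward neighbours) whose symbol obeys
`1 − φ(k) ≥ c₁‖k‖^α` on the punctured Brillouin zone (`0 < α < d`), the Green function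
`G_q = ∑_n P n` satisfies, for all finite `B, B'`:
`∑_{y∈B,y'∈B'} G_q(y − y') = (2π)^{-d} ∫_K W_{B,B'}(k) / (1 − φ(k)) dk`. -/
theorem green_block_two_eq (hd : 1 ≤ d) {q : Site d → ℝ} {P : ℕ → Site d → ℝ} {c₁ α : ℝ}
    (hα0 : 0 < α) (hαd : α < d)
    (hq0 : ∀ y, 0 ≤ q y) (hqs : Summable q) (hq1 : ∑' y, q y = 1) (hqev : ∀ y, q (-y) = q y)
    (y₁ : Site d) (hy₁ : 0 < q y₁) (hy₁' : ∀ i : Fin d, 0 < q (y₁ + Pi.single i 1))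
    (hP0 : ∀ z, P 0 z = if z = 0 then 1 else 0)
    (hPs : ∀ n z, P (n + 1) z = ∑' y, q y * P n (z - y))
    (hPnn : ∀ n z, 0 ≤ P n z) (hPsum : ∀ n, Summable (P n)) (hPn : ∀ z, Summable fun n => P n z)
    (hc₁ : 0 < c₁)
    (hlow : ∀ k : Fin d → ℝ, ‖k‖ ≤ π → k ≠ 0 →
      c₁ * ‖k‖ ^ α ≤ 1 - ∑' y, q y * Real.cos (phase d k y))
    (B B' : Finset (Site d)) :
    ∑ y ∈ B, ∑ y' ∈ B', ∑' n, P n (y - y')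
      = ((2 * π) ^ d)⁻¹ * ∫ k in Set.pi Set.univ (fun _ : Fin d => Set.Icc (-π) π),
          (∑ y ∈ B, ∑ y' ∈ B', Real.cos (phase d k (y - y'))) /
            (1 - ∑' y, q y * Real.cos (phase d k y)) := by
  set K := Set.pi Set.univ (fun _ : Fin d => Set.Icc (-π) π) with hK
  set W : (Fin d → ℝ) → ℝ := fun k => ∑ y ∈ B, ∑ y' ∈ B', Real.cos (phase d k (y - y')) with hW
  set φ : (Fin d → ℝ) → ℝ := fun k => ∑' y, q y * Real.cos (phase d k y) with hφ
  have hπ := Real.pi_pos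
  have h2π : (0 : ℝ) < (2 * π) ^ d := by positivity
  have hWcont : Continuous W := by
    simp only [hW]
    refine continuous_finsetSum _ fun y _ => continuous_finsetSum _ fun y' _ => ?_
    have := continuous_phase (d := d) (y - y'); fun_prop
  have hWbd : ∀ k, |W k| ≤ (B.card : ℝ) * B'.card := by
    intro k
    simp only [hW]
    calc |∑ y ∈ B, ∑ y' ∈ B', Real.cos (phase d k (y - y'))|
        ≤ ∑ y ∈ B, |∑ y' ∈ B', Real.cos (phase d k (y - y'))| := Finset.abs_sum_le_sum_abs _ _
      _ ≤ ∑ y ∈ B, ∑ y' ∈ B', |Real.cos (phase d k (y - y'))| :=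
          Finset.sum_le_sum fun y _ => Finset.abs_sum_le_sum_abs _ _
      _ ≤ ∑ y ∈ B, ∑ y' ∈ B', (1 : ℝ) :=
          Finset.sum_le_sum fun y _ => Finset.sum_le_sum fun y' _ => Real.abs_cos_le_one _
      _ = (B.card : ℝ) * B'.card := by simp
  have hφcont : Continuous φ := continuous_fourier_q hqs
  have hφabs : ∀ k, |φ k| ≤ 1 := fun k => abs_fourier_q_le_one hq0 hqs hq1.le k
  -- evenness of the powers and Parseval for each power
  have hPev : ∀ n z, P n (-z) = P n z := fun n z => convPow_even hqev hP0 hPs n z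
  have hpars : ∀ n, (2 * π) ^ d * ∑ y ∈ B, ∑ y' ∈ B', P n (y - y')
      = ∫ k in K, φ k ^ n * W k := by
    intro n
    rw [← parseval_block_two (hPsum n) (hPev n) B B']
    refine integral_congr_ae (Filter.Eventually.of_forall fun k => ?_)
    simp only [hφ, hW]
    rw [fourier_convPow hq0 hqs hqev hP0 hPs hPnn hPsum k n]
  -- the approximants `F_N = (∑_{n<N} φ^n) W` and their limit `W / (1 - φ)`
  have hint : ∀ n, Integrable (fun k => φ k ^ n * W k) (volume.restrict K) := fun n =>
    integrableOn_cube_of_continuous ((hφcont.pow n).mul hWcont)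
  have hFN : ∀ N, (2 * π) ^ d * ∑ n ∈ Finset.range N, ∑ y ∈ B, ∑ y' ∈ B', P n (y - y')
      = ∫ k in K, (∑ n ∈ Finset.range N, φ k ^ n) * W k := by
    intro N
    rw [Finset.mul_sum]
    simp_rw [hpars, Finset.sum_mul]
    rw [integral_finsetSum _ (fun n _ => hint n)]
  -- dominated convergence
  have hdom_int : Integrable (fun k : Fin d → ℝ => 2 / c₁ * (‖k‖ ^ (-α) * ((B.card : ℝ) * B'.card)))
      (volume.restrict K) :=
    (((integrableOn_norm_rpow_neg hd hα0.le hαd).mul_const _).const_mul _)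
  have hintN : ∀ N, Integrable (fun k => (∑ n ∈ Finset.range N, φ k ^ n) * W k) (volume.restrict K) := by
    intro N
    have : (fun k => (∑ n ∈ Finset.range N, φ k ^ n) * W k) = fun k => ∑ n ∈ Finset.range N, φ k ^ n * W k := by
      funext k; rw [Finset.sum_mul]
    rw [this]
    exact integrable_finsetSum _ (fun n _ => hint n)
  have hlim : Tendsto (fun N => ∫ k in K, (∑ n ∈ Finset.range N, φ k ^ n) * W k) atTop
      (𝓝 (∫ k in K, W k / (1 - φ k))) := by
    refine tendsto_integral_of_dominated_convergence
      (fun k => 2 / c₁ * (‖k‖ ^ (-α) * ((B.card : ℝ) * B'.card)))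
      (fun N => (hintN N).aestronglyMeasurable) hdom_int ?_ ?_
    · -- the bound
      intro N
      rw [ae_restrict_iff' (MeasurableSet.univ_pi fun _ => measurableSet_Icc)]
      filter_upwards [ae_ne_zero hd] with k hk0 hkK
      have hnk : 0 < ‖k‖ := norm_pos_iff.2 hk0
      have hkπ : ‖k‖ ≤ π := norm_le_pi_of_mem_cube hkK
      have hlowk := hlow k hkπ hk0
      have hpos : 0 < c₁ * ‖k‖ ^ α := by positivity
      have hφ1 : φ k < 1 := by simp only [hφ]; linarith
      have hg := geom_partial_sum_le (hφabs k) hφ1 N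
      have hg' : |∑ n ∈ Finset.range N, φ k ^ n| ≤ 2 / (1 - φ k) := by
        rw [abs_le]
        refine ⟨?_, hg⟩
        -- lower bound: `∑ φ^n = (1 - φ^N)/(1 - φ) ≥ 0`
        have h1 : (∑ n ∈ Finset.range N, φ k ^ n) * (1 - φ k) = 1 - φ k ^ N := geom_sum_mul_neg (φ k) N
        have h2 : 0 ≤ 1 - φ k ^ N := by
          have := abs_pow (φ k) N
          have h3 : |φ k| ^ N ≤ 1 := pow_le_one₀ (abs_nonneg _) (hφabs k)
          have : φ k ^ N ≤ 1 := (le_abs_self _).trans (by rw [abs_pow]; exact h3)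
          linarith
        have h4 : 0 ≤ ∑ n ∈ Finset.range N, φ k ^ n := by
          by_contra hneg
          rw [not_le] at hneg
          have : (∑ n ∈ Finset.range N, φ k ^ n) * (1 - φ k) < 0 := mul_neg_of_neg_of_pos hneg (by linarith)
          linarith
        have h5 : 0 ≤ 2 / (1 - φ k) := div_nonneg (by norm_num) (by linarith)
        linarith
      have h3 : 2 / (1 - φ k) ≤ 2 / c₁ * ‖k‖ ^ (-α) := by
        rw [Real.rpow_neg hnk.le, ← div_eq_mul_inv, div_div]
        exact div_le_div_of_nonneg_left (by norm_num) hpos hlowk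
      rw [Real.norm_eq_abs, abs_mul]
      calc |∑ n ∈ Finset.range N, φ k ^ n| * |W k| ≤ (2 / (1 - φ k)) * ((B.card : ℝ) * B'.card) :=
            mul_le_mul hg' (hWbd k) (abs_nonneg _) (div_nonneg (by norm_num) (by linarith))
        _ ≤ (2 / c₁ * ‖k‖ ^ (-α)) * ((B.card : ℝ) * B'.card) :=
            mul_le_mul_of_nonneg_right h3 (by positivity)
        _ = 2 / c₁ * (‖k‖ ^ (-α) * ((B.card : ℝ) * B'.card)) := by ring
    · -- pointwise convergence off the origin (`|φ| < 1` there)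
      rw [ae_restrict_iff' (MeasurableSet.univ_pi fun _ => measurableSet_Icc)]
      filter_upwards [ae_ne_zero hd] with k hk0 hkK
      have hkπ : ‖k‖ ≤ π := norm_le_pi_of_mem_cube hkK
      have hlowk := hlow k hkπ hk0
      have hpos : 0 < c₁ * ‖k‖ ^ α := by have := norm_pos_iff.2 hk0; positivity
      have hφ1 : φ k < 1 := by simp only [hφ]; linarith
      have hφ2 : -1 < φ k := neg_one_lt_fourier hq0 hqs hq1 y₁ hy₁ hy₁' hkπ
      have habs : |φ k| < 1 := abs_lt.2 ⟨hφ2, hφ1⟩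
      have hgeom := hasSum_geometric_of_abs_lt_one habs
      have := (hgeom.tendsto_sum_nat).mul_const (W k)
      rw [show (1 - φ k)⁻¹ * W k = W k / (1 - φ k) by rw [div_eq_inv_mul]] at this
      exact this
  -- the left-hand side converges to the Green block sum
  have hlhs : Tendsto (fun N => (2 * π) ^ d * ∑ n ∈ Finset.range N, ∑ y ∈ B, ∑ y' ∈ B', P n (y - y'))
      atTop (𝓝 ((2 * π) ^ d * ∑ y ∈ B, ∑ y' ∈ B', ∑' n, P n (y - y'))) := by
    refine Tendsto.const_mul _ ?_
    have h1 : ∀ N, ∑ n ∈ Finset.range N, ∑ y ∈ B, ∑ y' ∈ B', P n (y - y')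
        = ∑ y ∈ B, ∑ y' ∈ B', ∑ n ∈ Finset.range N, P n (y - y') := fun N => by
      rw [Finset.sum_comm]
      refine Finset.sum_congr rfl fun y _ => ?_
      rw [Finset.sum_comm]
    simp_rw [h1]
    exact tendsto_finsetSum _ fun y _ => tendsto_finsetSum _ fun y' _ =>
      (hPn (y - y')).hasSum.tendsto_sum_nat
  simp_rw [hFN] at hlhs
  have heq := tendsto_nhds_unique hlhs hlim
  rw [← heq]
  field_simp

end Parseval

end Summit.CriticalPhenomena.Ising3DConformalLimit.Theorems.SpineGlue

end
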